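import Summits.NavierStokesRegularity.NavierStokesRegularity.Theorems.ApexLocalisation.Negative.LogicAndLoadBearing
import Literature.Analysis.FluidPDE.KNSSTypeIRateLiouvilleMild
import Literature.Analysis.FluidPDE.LocalTypeILiouville
import Literature.Analysis.FluidPDE.NSBoundedMildOseen
import Literature.Analysis.FluidPDE.SuitableWeakCongr
import Literature.Analysis.FluidPDE.LocalTypeICongr
import Literature.Analysis.FluidPDE.KNSSWeakDriftMild
import Literature.Analysis.UnboundedOperators.HeatKernelHeatEquation

/-!
# drefute — line `decaying-ancient-bridge` (crux stmt-NavierStokesRegularity-11719 `ApexLocalisation`)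

Refuter certificates for the lead's skeleton `Cruxes/ApexLocalisation/Lines/decaying-ancient-bridge.lean`
(namespace `…Theorems.RellichScarApexLocalisation`, 6 stubs). No stub is cheaply false; this file records
WHY in Lean:

* `InClass C B M` — the inlined class 𝒜(C,B) of the skeleton (verbatim conjuncts), and
  `nontrivialMildAncientTypeIExists_of_inClass` : a non-trivial member is a witness of Albritton–Barker's
  OPEN second bullet `NontrivialMildAncientTypeIExists` (via the tree bridge `isBoundedAncientMildSolution_of_oseen`);
  `not_liouville_of_inClass` : … and refutes the KNSS Liouville conjecture (L).
* `hullSelection_of_not_nontrivial`, `hullSelection_of_liouville` : THE BET (`stub_hullSelection`) holds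
  vacuously under `¬ NontrivialMildAncientTypeIExists`, in particular under (L) — irrefutable short of a
  Type-I ancient solution (exactly like the crux).
* `hullClosed_of_not_nontrivial` : likewise `stub_hullClosed` (the only class members are then `M = 0` on
  the slab, whose hull limits vanish on the slab).
* `rateToAncient_of_not_rateProfileExists` : `stub_rateToAncient` is (L)-vacuous (antecedent = `IsRateProfile C`);
  `nontrivial_of_rateToAncient` : conversely the stub (fed any engine) proves A–B Thm 1.1 (⇒) for rate profiles.
* `morrey_nonneg` : in `stub_radiationBound` the hypothesis `0 ≤ I` is implied by the Morrey hypothesis (redundant).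
* conformance `example`s: the restated propositions are definitionally the types of the lead's stubs.
-/

set_option linter.dupNamespace false
set_option linter.unusedVariables false

noncomputable section

open MeasureTheory Set Function Metric Filter Topology TopologicalSpace
open scoped ENNReal NNReal
open Literature.Analysis Literature.Analysis.FluidPDE
open Summit.NavierStokesRegularity.NavierStokesRegularity.Theorems.ApexLocalisation.Negative

namespace Summit.NavierStokesRegularity.NavierStokesRegularity.Cruxes.ApexLocalisation.DrefuteDAB

local notation "E³" => EuclideanSpace ℝ (Fin 3)

/-! ## The inlined class and the stub statements, restated -/

/-- The class 𝒜(C,B) of the skeleton, verbatim. -/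
def InClass (C B : ℝ) (M : ℝ → E³ → E³) : Prop :=
  ContinuousOn (uncurry M) (Iio (0 : ℝ) ×ˢ univ) ∧
    (∀ t < 0, IsWeaklyDivFree (M t)) ∧
    (∀ s t : ℝ, s < t → t < 0 → ∀ x : E³,
      M t x = UnboundedOperators.heatExtension (M s) (t - s) x - oseenDuhamel 1 s M M t x) ∧
    (∀ t < 0, ∀ x : E³, ‖M t x‖ ≤ B) ∧
    HasTypeITimeDecay C M ∧
    (∃ (q : ℝ → E³ → ℝ) (H : ℝ → E³ → E³ →L[ℝ] E³),
      IsSuitableWeakSolutionOn (slab E³ (Iio 0) isOpen_Iio) 1 0 M q ∧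
      HasWeakSpatialGradientOn (slab E³ (Iio 0) isOpen_Iio) M H ∧
      typeIBound (Iio (0 : ℝ) ×ˢ univ) M q H < ⊤)

/-- The engine statement (`stub_slabCompactness`), verbatim. -/
def Engine : Prop :=
  ∀ (I : ℝ≥0∞) (v : ℕ → ℝ → E³ → E³) (q : ℕ → ℝ → E³ → ℝ) (G : ℕ → ℝ → E³ → E³ →L[ℝ] E³),
      I < ⊤ →
      (∀ k, IsSuitableWeakSolutionOn (slab E³ (Iio 0) isOpen_Iio) 1 0 (v k) (q k)) →
      (∀ k, HasWeakSpatialGradientOn (slab E³ (Iio 0) isOpen_Iio) (v k) (G k)) →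
      (∀ k, typeIBound (Iio (0 : ℝ) ×ˢ univ) (v k) (q k) (G k) ≤ I) →
      ∃ (u : ℝ → E³ → E³) (p : ℝ → E³ → ℝ) (H : ℝ → E³ → E³ →L[ℝ] E³) (σ : ℕ → ℕ),
        StrictMono σ ∧
        IsSuitableWeakSolutionOn (slab E³ (Iio 0) isOpen_Iio) 1 0 u p ∧
        HasWeakSpatialGradientOn (slab E³ (Iio 0) isOpen_Iio) u H ∧
        typeIBound (Iio (0 : ℝ) ×ˢ univ) u p H ≤ 4 * I ∧
        (∀ R : ℝ, 0 < R → Tendsto (fun j => eLpNorm (uncurry (v (σ j)) - uncurry u) 3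
          (volume.restrict (parabolicCylinder R (0 : ℝ × E³)))) atTop (𝓝 0)) ∧
        ((∀ R : ℝ, 0 < R → limsup (fun j => eLpNorm (uncurry (v (σ j))) ⊤
            (volume.restrict (parabolicCylinder R (0 : ℝ × E³)))) atTop = ⊤) →
          IsBackwardSingularPoint u 0)

/-- The radiation bound with constant `c₀` (matrix of `stub_radiationBound`), verbatim. -/
def RadiationBoundWith (c₀ : ℝ) : Prop :=
  ∀ (I B : ℝ) (M : ℝ → E³ → E³), 0 ≤ I →
      ContinuousOn (uncurry M) (Iio (0 : ℝ) ×ˢ univ) →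
      (∀ t < 0, ∀ x : E³, ‖M t x‖ ≤ B) →
      (∀ τ < 0, ∀ (z : E³) (r : ℝ), 0 < r → ∫ y in ball z r, ‖M τ y‖ ^ 2 ≤ I * r) →
      ∀ (s t : ℝ), s < t → t < 0 → ∀ x : E³, x ≠ 0 →
        ‖∫ τ in Ioo s t, ∫ y in {y : E³ | ‖x‖ / 2 ≤ ‖y - x‖},
            oseenKernel (t - τ) (x - y) (M τ y) (M τ y)‖ ≤ c₀ * I / ‖x‖

/-- `stub_hullSelection`, restated over `InClass`. -/
def HullSelection : Prop :=
  (∃ c₀ : ℝ, RadiationBoundWith c₀) →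
    ∀ (C B : ℝ) (M : ℝ → E³ → E³), InClass C B M →
      (∃ s : ℝ, s < 0 ∧ ∃ y : E³, M s y ≠ 0) →
      ∃ (xk : ℕ → E³) (tk : ℕ → ℝ) (lk : ℕ → ℝ) (N : ℝ → E³ → E³),
        (∀ k, tk k ≤ 0 ∧ 0 < lk k ∧ lk k ≤ 1) ∧
        (∀ t < 0, TendstoLocallyUniformly
          (fun k (y : E³) => lk k • M (tk k + lk k ^ 2 * t) (xk k + lk k • y)) (N t) atTop) ∧
        ContinuousOn (uncurry N) (Iio (0 : ℝ) ×ˢ univ) ∧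
        (∃ s : ℝ, s < 0 ∧ ∃ y : E³, N s y ≠ 0) ∧
        ∃ K : ℝ, ∀ s < 0, ∀ y : E³, ‖y‖ * ‖N s y‖ ≤ K

/-- `stub_hullClosed`, restated over `InClass`. -/
def HullClosed : Prop :=
  Engine →
    ∀ (C B : ℝ) (M : ℝ → E³ → E³) (xk : ℕ → E³) (tk : ℕ → ℝ) (lk : ℕ → ℝ) (N : ℝ → E³ → E³),
      InClass C B M →
      (∀ k, tk k ≤ 0 ∧ 0 < lk k ∧ lk k ≤ 1) →
      (∀ t < 0, TendstoLocallyUniformly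
        (fun k (y : E³) => lk k • M (tk k + lk k ^ 2 * t) (xk k + lk k • y)) (N t) atTop) →
      ContinuousOn (uncurry N) (Iio (0 : ℝ) ×ˢ univ) →
      InClass C B N

/-- `stub_rateToAncient`, restated over `InClass`. -/
def RateToAncient : Prop :=
  Engine →
    ∀ C : ℝ,
      (∃ (u : ℝ → E³ → E³) (p : ℝ → E³ → ℝ) (G : ℝ → E³ → E³ →L[ℝ] E³),
        IsSuitableWeakSolutionOn (slab E³ (Iio 0) isOpen_Iio) 1 0 u p ∧
        HasWeakSpatialGradientOn (slab E³ (Iio 0) isOpen_Iio) u G ∧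
        typeIBound (Iio (0 : ℝ) ×ˢ univ) u p G < ⊤ ∧ HasTypeITimeDecay C u ∧
        IsBackwardSingularPoint u 0) →
      ∃ (B : ℝ) (M : ℝ → E³ → E³), InClass C B M ∧ (∃ s : ℝ, s < 0 ∧ ∃ y : E³, M s y ≠ 0)

/-! ### Conformance
The restatements above are copied verbatim from the lead's skeleton (sha of the published
`Lines/decaying-ancient-bridge.lean`, 2026-08-16T00:22Z); the skeleton module itself is not built on the
farm (`Cruxes/…/Lines/*.olean` absent), so conformance is textual, not by `type_of%`. -/

/-- Glue copied from the skeleton: a field continuous on the open slab which does not vanish at some point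
of the slab is not a.e. zero there. -/
theorem not_ae_eq_zero_of_continuousOn {N : ℝ → E³ → E³}
    (hcont : ContinuousOn (uncurry N) (Iio (0 : ℝ) ×ˢ univ)) {s : ℝ} (hs : s < 0) {y : E³}
    (hy : N s y ≠ 0) :
    ¬ (uncurry N =ᵐ[volume.restrict (Iio (0 : ℝ) ×ˢ (univ : Set E³))] 0) := by
  intro h
  have hSopen : IsOpen (Iio (0 : ℝ) ×ˢ (univ : Set E³)) := isOpen_Iio.prod isOpen_univ
  have hUopen : IsOpen ((Iio (0 : ℝ) ×ˢ (univ : Set E³)) ∩ (uncurry N) ⁻¹' ({0}ᶜ)) :=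
    hcont.isOpen_inter_preimage hSopen isOpen_compl_singleton
  have hmem : ((s, y) : ℝ × E³) ∈ (Iio (0 : ℝ) ×ˢ (univ : Set E³)) ∩ (uncurry N) ⁻¹' ({0}ᶜ) :=
    ⟨⟨hs, mem_univ _⟩, hy⟩
  have hpos : 0 < volume ((Iio (0 : ℝ) ×ˢ (univ : Set E³)) ∩ (uncurry N) ⁻¹' ({0}ᶜ)) :=
    hUopen.measure_pos volume ⟨(s, y), hmem⟩
  have hzero : volume.restrict (Iio (0 : ℝ) ×ˢ (univ : Set E³)) ((uncurry N) ⁻¹' ({0}ᶜ)) = 0 := by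
    have h' : ∀ᵐ z ∂(volume.restrict (Iio (0 : ℝ) ×ˢ (univ : Set E³))), z ∉ (uncurry N) ⁻¹' ({0}ᶜ) := by
      filter_upwards [h] with z hz
      simp [hz]
    exact measure_eq_zero_iff_ae_notMem.2 h'
  rw [Measure.restrict_apply' hSopen.measurableSet, inter_comm] at hzero
  exact hpos.ne' hzero

/-! ## §1 A non-trivial class member is a Type-I ancient solution (A–B's open second bullet) -/

variable {C B : ℝ} {M : ℝ → E³ → E³}

/-- Class members are bounded ancient mild solutions in the tree's duality form. -/
theorem isBoundedAncientMildSolution_of_inClass (h : InClass C B M) :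
    IsBoundedAncientMildSolution 1 M := by
  obtain ⟨hcont, hdiv, hmild, hB, -, -⟩ := h
  refine isBoundedAncientMildSolution_of_oseen one_pos hcont ⟨B, hB⟩ hdiv ?_
  intro s t hst ht x
  rw [one_mul]
  exact hmild s t hst ht x

/-- **A non-trivial member of 𝒜(C,B) witnesses `NontrivialMildAncientTypeIExists`** (registered OPEN,
expected false under (L)). Hence every universal stub over non-trivial class members is (L)-vacuous. -/
theorem nontrivialMildAncientTypeIExists_of_inClass (h : InClass C B M)
    (hnt : ∃ s : ℝ, s < 0 ∧ ∃ y : E³, M s y ≠ 0) : NontrivialMildAncientTypeIExists := by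
  have hmild := isBoundedAncientMildSolution_of_inClass h
  obtain ⟨hcont, -, -, -, -, q, H, hsws, hgrad, hI⟩ := h
  obtain ⟨s, hs, y, hy⟩ := hnt
  exact ⟨M, q, H, hmild, hsws, hgrad, not_ae_eq_zero_of_continuousOn hcont hs hy, hI⟩

/-- … with measurable slices (continuity), so it also refutes the KNSS Liouville conjecture (L). -/
theorem not_liouville_of_inClass (h : InClass C B M)
    (hnt : ∃ s : ℝ, s < 0 ∧ ∃ y : E³, M s y ≠ 0) : ¬ LiouvilleConjectureNS := by
  have hmild := isBoundedAncientMildSolution_of_inClass h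
  obtain ⟨hcont, -, -, -, -, q, H, hsws, hgrad, hI⟩ := h
  obtain ⟨s, hs, y, hy⟩ := hnt
  have hmeas : ∀ t < 0, AEStronglyMeasurable (M t) volume := fun t ht =>
    (hcont.comp_continuous (f := fun x : E³ => (t, x)) (by fun_prop)
      fun x => ⟨ht, mem_univ _⟩).aestronglyMeasurable
  exact (not_liouvilleConjectureNS_of_nontrivialMildAncientTypeI_measurable
    ⟨M, q, H, hmeas, hmild, hsws, hgrad, not_ae_eq_zero_of_continuousOn hcont hs hy, hI⟩).2

/-! ### The class is consistently stated: the zero field is a member (and, under (L), the only one) -/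

/-- **Non-junk check of the inlined class**: `M = 0` satisfies every conjunct of 𝒜(C,B) iff `0 ≤ C`
and `0 ≤ B` — the Oseen identity, the heat term and the Duhamel term are honest (`0 = 0 - 0`), the
suitable-weak data are those of the zero flow (`𝐈 = 0`). So the universal stubs 3–4 are not vacuous
for a junk reason (unsatisfiable hypotheses); they are vacuous exactly modulo Type-I ancient solutions. -/
theorem inClass_zero (hC : 0 ≤ C) (hB : 0 ≤ B) : InClass C B (0 : ℝ → E³ → E³) := by
  have hs := parasitic_isSuitableWeakSolutionOn 0
  have hg := parasitic_hasWeakSpatialGradientOn 0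
  rw [parasiticVelocity_zero] at hs hg
  rw [parasiticPressure_zero] at hs
  have hG : (fun (t : ℝ) (x : E³) => fderiv ℝ ((0 : ℝ → E³ → E³) t) x) = 0 := by
    funext t x
    simp
  rw [hG] at hg
  refine ⟨continuousOn_const, fun t _ => isWeaklyDivFree_const (0 : E³), fun s t _ _ x => ?_,
    fun t _ x => by simpa using hB, fun t _ x => ?_, 0, 0, hs, hg, ?_⟩
  · have h0 : (0 : ℝ → E³ → E³) s = fun _ : E³ => (0 : E³) := rfl
    have h1 : UnboundedOperators.heatExtension ((0 : ℝ → E³ → E³) s) (t - s) = 0 := by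
      rw [h0]
      exact UnboundedOperators.heatExtension_zero_fun (t - s)
    rw [h1, oseenDuhamel_zero_left]
    simp
  · simp only [Pi.zero_apply, norm_zero]
    positivity
  · rw [typeIBound_zero]
    exact ENNReal.zero_lt_top

/-- `InClass C B 0 ↔ 0 ≤ C ∧ 0 ≤ B`. -/
theorem inClass_zero_iff : InClass C B (0 : ℝ → E³ → E³) ↔ 0 ≤ C ∧ 0 ≤ B := by
  refine ⟨fun h => ⟨?_, ?_⟩, fun h => inClass_zero h.1 h.2⟩
  · have := h.2.2.2.2.1 (-1) (by norm_num) 0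
    simp only [Pi.zero_apply, norm_zero, neg_neg, Real.sqrt_one, div_one] at this
    exact this
  · simpa using h.2.2.2.1 (-1) (by norm_num) 0

/-! ## §2 THE BET and the hull closure are (L)-vacuous -/

/-- `stub_hullSelection` from `¬ NontrivialMildAncientTypeIExists`. -/
theorem hullSelection_of_not_nontrivial (hno : ¬ NontrivialMildAncientTypeIExists) : HullSelection :=
  fun _ _ _ _ hM hnt => absurd (nontrivialMildAncientTypeIExists_of_inClass hM hnt) hno

/-- `stub_hullSelection` from the Liouville conjecture (L). -/
theorem hullSelection_of_liouville (hL : LiouvilleConjectureNS) : HullSelection :=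
  fun _ _ _ _ hM hnt => absurd hL (not_liouville_of_inClass hM hnt)

/-- Under `¬ NontrivialMildAncientTypeIExists` every class member vanishes identically on the slab. -/
theorem eq_zero_of_inClass (hno : ¬ NontrivialMildAncientTypeIExists) (h : InClass C B M) :
    ∀ s < 0, ∀ y : E³, M s y = 0 := by
  by_contra hne
  push Not at hne
  obtain ⟨s, hs, y, hy⟩ := hne
  exact hno (nontrivialMildAncientTypeIExists_of_inClass h ⟨s, hs, y, hy⟩)

/-- A slice-wise locally uniform limit of hull images of a field vanishing on the slab vanishes on the slab. -/
theorem hullLimit_eq_zero (hM : ∀ s < 0, ∀ y : E³, M s y = 0)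
    {xk : ℕ → E³} {tk lk : ℕ → ℝ} {N : ℝ → E³ → E³}
    (hadm : ∀ k, tk k ≤ 0 ∧ 0 < lk k ∧ lk k ≤ 1)
    (hconv : ∀ t < 0, TendstoLocallyUniformly
      (fun k (y : E³) => lk k • M (tk k + lk k ^ 2 * t) (xk k + lk k • y)) (N t) atTop) :
    ∀ t < 0, ∀ y : E³, N t y = 0 := by
  intro t ht y
  have h1 : Tendsto (fun k => lk k • M (tk k + lk k ^ 2 * t) (xk k + lk k • y)) atTop (𝓝 (N t y)) :=
    ((hconv t ht).tendstoLocallyUniformlyOn (s := (univ : Set E³))).tendsto_at (mem_univ y)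
  have h2 : (fun k => lk k • M (tk k + lk k ^ 2 * t) (xk k + lk k • y)) = fun _ => 0 := by
    funext k
    have htk : tk k + lk k ^ 2 * t < 0 := by
      have := mul_neg_of_pos_of_neg (pow_pos (hadm k).2.1 2) ht
      linarith [(hadm k).1]
    rw [hM _ htk, smul_zero]
  rw [h2] at h1
  exact tendsto_nhds_unique h1 tendsto_const_nhds

/-- The class conjuncts hold for any field vanishing on the slab (with `0 ≤ B`, `0 ≤ C`), given that they
hold for SOME such field supplying the suitable-weak data — here transported from `M` itself. -/
theorem inClass_of_eq_zero (hM : InClass C B M) (hM0 : ∀ s < 0, ∀ y : E³, M s y = 0)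
    {N : ℝ → E³ → E³} (hN0 : ∀ s < 0, ∀ y : E³, N s y = 0)
    (hNcont : ContinuousOn (uncurry N) (Iio (0 : ℝ) ×ˢ univ)) : InClass C B N := by
  obtain ⟨-, hdiv, hmild, hB, hC, q, H, hsws, hgrad, hI⟩ := hM
  -- `N` and `M` have the same slices on the slab
  have hslice : ∀ t < 0, N t = M t := fun t ht => funext fun y => by rw [hN0 t ht y, hM0 t ht y]
  have hNM : uncurry N =ᵐ[volume.restrict (Iio (0 : ℝ) ×ˢ (univ : Set E³))] uncurry M := by
    refine ae_restrict_of_forall_mem (measurableSet_Iio.prod MeasurableSet.univ) ?_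
    rintro ⟨t, y⟩ ⟨ht, -⟩
    simp [uncurry, hN0 t ht y, hM0 t ht y]
  have hNM' : ∀ᵐ w ∂(volume.restrict ((slab E³ (Iio 0) isOpen_Iio : Opens (ℝ × E³)) : Set (ℝ × E³))),
      uncurry M w = uncurry N w := by
    rw [coe_slab]
    filter_upwards [hNM] with w hw
    exact hw.symm
  refine ⟨hNcont, fun t ht => hslice t ht ▸ hdiv t ht, fun s t hst ht x => ?_, fun t ht x => ?_,
    fun t ht x => ?_, q, H, ?_, ?_, ?_⟩
  · -- Oseen identity: every term only sees slices at negative times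
    have hs : s < 0 := hst.trans ht
    have key := hmild s t hst ht x
    rw [hslice t ht, hslice s hs]
    have hD : oseenDuhamel 1 s N N t x = oseenDuhamel 1 s M M t x := by
      simp only [oseenDuhamel_apply]
      refine setIntegral_congr_fun measurableSet_Ioo fun τ hτ => ?_
      rw [hslice τ (hτ.2.trans ht)]
    rw [hD]
    exact key
  · rw [hN0 t ht x, norm_zero]; exact (norm_nonneg _).trans (hB t ht x)
  · rw [hN0 t ht x, norm_zero]; exact (norm_nonneg _).trans (hC t ht x)
  · exact hsws.congr_ae hNM' (ae_of_all _ fun _ => rfl)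
  · exact hgrad.congr_ae hNM'
  · rwa [typeIBound_congr_ae hNM]

/-- `stub_hullClosed` from `¬ NontrivialMildAncientTypeIExists` (only `M = 0` on the slab is in the class,
and its hull limits vanish on the slab). -/
theorem hullClosed_of_not_nontrivial (hno : ¬ NontrivialMildAncientTypeIExists) : HullClosed := by
  intro _ C B M xk tk lk N hM hadm hconv hNcont
  have hM0 := eq_zero_of_inClass hno hM
  exact inClass_of_eq_zero hM hM0 (hullLimit_eq_zero hM0 hadm hconv) hNcont

/-! ## §3 The ⇒ transfer: (L)-vacuous, and conversely as strong as A–B (⇒) on rate profiles -/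

/-- `stub_rateToAncient` from `¬ RateProfileExists` (its antecedent is `IsRateProfile C`). -/
theorem rateToAncient_of_not_rateProfileExists (hno : ¬ RateProfileExists) : RateToAncient :=
  fun _ C ⟨u, p, G, h⟩ => absurd ⟨C, u, p, G, h⟩ hno

/-- Conversely the stub, fed ANY engine, proves A–B Thm 1.1 (⇒) restricted to rate profiles. -/
theorem nontrivial_of_rateToAncient (h : RateToAncient) (hE : Engine) (hr : RateProfileExists) :
    NontrivialMildAncientTypeIExists := by
  obtain ⟨C, u, p, G, hu⟩ := hr
  obtain ⟨B, M, hM, hnt⟩ := h hE C ⟨u, p, G, hu⟩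
  exact nontrivialMildAncientTypeIExists_of_inClass hM hnt

/-! ## §4 `stub_radiationBound`: `0 ≤ I` is redundant -/

/-- The Morrey hypothesis at one negative time, one centre and one radius already forces `0 ≤ I`. -/
theorem morrey_nonneg {I : ℝ} {M : ℝ → E³ → E³}
    (hMor : ∀ τ < 0, ∀ (z : E³) (r : ℝ), 0 < r → ∫ y in ball z r, ‖M τ y‖ ^ 2 ≤ I * r) : 0 ≤ I := by
  have h := hMor (-1) (by norm_num) 0 1 one_pos
  have h0 : 0 ≤ ∫ y in ball (0 : E³) 1, ‖M (-1) y‖ ^ 2 := integral_nonneg fun y => by positivity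
  linarith

/-- Hence the radiation bound without `0 ≤ I` is equivalent to the lead's. -/
theorem radiationBoundWith_iff_without_nonneg (c₀ : ℝ) :
    RadiationBoundWith c₀ ↔
      ∀ (I B : ℝ) (M : ℝ → E³ → E³),
        ContinuousOn (uncurry M) (Iio (0 : ℝ) ×ˢ univ) →
        (∀ t < 0, ∀ x : E³, ‖M t x‖ ≤ B) →
        (∀ τ < 0, ∀ (z : E³) (r : ℝ), 0 < r → ∫ y in ball z r, ‖M τ y‖ ^ 2 ≤ I * r) →
        ∀ (s t : ℝ), s < t → t < 0 → ∀ x : E³, x ≠ 0 →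
          ‖∫ τ in Ioo s t, ∫ y in {y : E³ | ‖x‖ / 2 ≤ ‖y - x‖},
              oseenKernel (t - τ) (x - y) (M τ y) (M τ y)‖ ≤ c₀ * I / ‖x‖ :=
  ⟨fun h I B M hc hB hMor => h I B M (morrey_nonneg hMor) hc hB hMor,
    fun h I B M _ hc hB hMor => h I B M hc hB hMor⟩

end Summit.NavierStokesRegularity.NavierStokesRegularity.Cruxes.ApexLocalisation.DrefuteDAB

end
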